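import Literature.MathematicalPhysics.QuantumFieldTheory.Balaban1983to89.B1Eq324BenfattoSect5HlCumulants
import Literature.MathematicalPhysics.QuantumFieldTheory.Balaban1983to89.B1Eq324BenfattoSect5Psi3Cumulants
import Literature.MathematicalPhysics.QuantumFieldTheory.Balaban1983to89.B1Eq324BenfattoSect5Eq534Cumulants
import Literature.MathematicalPhysics.QuantumFieldTheory.Balaban1983to89.B1Eq324BenfattoSect5TupleClusters
import Literature.MathematicalPhysics.QuantumFieldTheory.Balaban1983to89.B1Eq324BenfattoSect5PerBoxAtPavement
import HarnessLib

/-!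
# `Balaban1983to89.B1Eq324BenfattoSect5IdErrBounds` — [BenfattoEtAl1978] §5 pp. 155–159: THE DISPLAYED CORRECTION TERMS OF THE IDENTIFICATION
# (`…Sect5Identification`) BOUNDED BY THE LANDED CLUSTER THEOREMS — (5.11) + (5.24) inside the free cumulants for «H_J vs X», (5.33)–(5.34) for
# «H_{Γ̄₁} vs Y», Appendix D under `P̂₀` for the within-box (5.29)-type colourings; the class bookkeeping done by set differences only

statement-level skeleton of published theorems with citation tags; proofs where landed; nothing here is a claim about the
Yang–Mills mass gap

WHY THIS MODULE (cell `pub-ymgap`, seat `dag-n08-c` gen 19, INTENT-7; node N08 [Balaban1985UV3]).  `…Sect5Identification.identification_lower/upper`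
leave four terms per order displayed inside `idErr`: `|Ê₀^T(H_J;k+1) − Ê₀^T(X;k+1)|`, `|Ê₀^T(H_{Γ̄₁};k+1) − Ê₀^T(Y;k+1)|`, `|CROSS_k|`, `|Σ_□W₂₉,k(□)|`
(`X = H_{Γ₁}+Σ_□(Ψ₁+Ψ₂)(□)`, `Y = H_{Γ₁}+Σ_□(Ψ′₁+Ψ₂)(□)`).  The sibling seats proved the bounds in TUPLE-CLASS currency for an arbitrary base
class `T_X`: (5.11) in cumulants `…Sect5HlCumulants.abs_truncatedExp_hamiltonian_sub_hatH_le` (`H_J` vs `Ĥ_J`), the `Ψ₃`-removal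
`…Sect5Psi3Cumulants.abs_cumulantOf_add_psi3_sub_le` (`T_X + Ψ₃-class` vs `T_X`), the (5.33) correction / (5.34) remainder
`…Sect5Eq534Cumulants.abs_cumulantOf_add_corr_sub_le` / `abs_cumulantOf_add_remainder_sub_le`, and Appendix D for tuple-class slots
`…Sect5TupleClusters.abs_ursellOf_tupleSums_condField_le_exp_of_separated`.  What was left «to the assembler» is the CLASS BOOKKEEPING: present
`X`, `Y`, `Y + Σcorr` as single tuple-class sums.  This file does it with set DIFFERENCES only — `X = Σ over hatTuples ∖ ⋃_□Ψ₃cls(□)`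
(`Ĥ_J = X + Σ_□Ψ₃`), `Y + Σ_□corr(□) = Σ over hatTuplesBar` (`H_{Γ̄₁} = (Y + Σcorr) + rem`), `Y = Σ over hatTuplesBar ∖ ⋃_□corrCls(□)` — and derives
the three bounds; the within-box colourings are Appendix D at `Γ = ∅` with print's `Γ₄`-geometry (as in `…PerBoxAppD`, but `condMean ∅ = 0`).

DICTIONARY.  As in `…Sect5Identification` / `…Sect5FreeStep`; `Ψ₃cls(□_m) = crossT(□′,Γ₂) ∖ crossT(□′,Γ₃)` (`…Psi3Cumulants`),
`corrCls(□_m) = crossT(Γ₄,Γ₂) ∖ crossT(Γ₄,Γ₃)` and `rem = tuplesIn Γ̄₁ ∖ hatTuplesBar` (`…Eq534Cumulants`).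

WHAT IS PROVED (theorems only; no definition, no named fact, no `sorry`; axioms standard).
* §0 `tupleSum_sdiff_eq`, `truncatedExp_congr`.
* §1 «H_J vs X»: `psi3Class_subset_hatTuples`, ★ `X_eq_tupleSum`, `hatH_eq_X_add_psi3Sum`, ★★ `abs_truncatedExp_hamiltonian_sub_X_le`.
* §2 «H_{Γ̄₁} vs Y»: `corrClass_subset_hatTuplesBar`, ★ `Y_add_corr_eq_tupleSum`, ★ `Y_eq_tupleSum`, `hamiltonian_corridorsBar_eq_tupleSum_add_rem`,
  ★★ `abs_truncatedExp_corridorsBar_sub_Y_le`.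
* §3 «W₂₉ under P̂₀»: `slot_eq_tupleSum`, ★★ `abs_W29_le` (per box and colouring), ★★ `abs_sum_W29_le` (summed: `≤ |B|·3^{k+1}·(…)·e^{−(δ/2)(v+1)}·M̃^{k+1}`).

HONEST SCOPE / NOT HERE.  Instantiations and set bookkeeping over landed theorems; `|CROSS_k|` is the sibling seat's `…FreeStepCrossBound` (not
restated here); the conversion of these closed bounds into `|I|·errTerm` is the ledger's (`…ErrTermLedger`, `…StructuralErrors`).  `BasicLemmaPrinted`
stays OPEN; count-neutral for N08; nothing of [Balaban1985UV3] (41)/(47)/(5) is asserted; nothing about d = 4, the continuum, OS axioms, a mass gap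
or the Clay problem.
-/

noncomputable section

open MeasureTheory ProbabilityTheory Finset
open scoped BigOperators Nat

namespace Literature.MathematicalPhysics.QuantumFieldTheory.Balaban1983to89.B1Eq324BenfattoSect5IdErrBounds

open _root_.MeasureTheory _root_.ProbabilityTheory
open Literature.Probability.LatticeModels (setPartitions ursellOf cumulantOf)
open Literature.MathematicalPhysics.QuantumFieldTheory
open Literature.MathematicalPhysics.QuantumFieldTheory.Balaban1983to89.B1Eq324BenfattoLemma
open Literature.MathematicalPhysics.QuantumFieldTheory.Balaban1983to89.B1Eq324BenfattoSect5Boxes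
open Literature.MathematicalPhysics.QuantumFieldTheory.Balaban1983to89.B1Eq324BenfattoSect5Eq511
open Literature.MathematicalPhysics.QuantumFieldTheory.Balaban1983to89.B1Eq324BenfattoSect5Eq524
open Literature.MathematicalPhysics.QuantumFieldTheory.Balaban1983to89.B1Eq324BenfattoSect5Eq534
open Literature.MathematicalPhysics.QuantumFieldTheory.Balaban1983to89.B1Eq324BenfattoSect5HlCumulants
  (hatH_eq_tupleSum abs_truncatedExp_hamiltonian_sub_hatH_le)
open Literature.MathematicalPhysics.QuantumFieldTheory.Balaban1983to89.B1Eq324BenfattoSect5Psi3Cumulants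
  (tupleSum_psi3Class_eq_sum_psi3 abs_cumulantOf_add_psi3_sub_le)
open Literature.MathematicalPhysics.QuantumFieldTheory.Balaban1983to89.B1Eq324BenfattoSect5Eq534Cumulants
  (tupleSum_corrClass_eq_sum abs_cumulantOf_add_corr_sub_le abs_cumulantOf_add_remainder_sub_le)
open Literature.MathematicalPhysics.QuantumFieldTheory.Balaban1983to89.B1Eq324BenfattoSect5PerBoxOnData
  (psi1p_eq_tupleSum psi1pp_eq_tupleSum psi2_eq_tupleSum)
open Literature.MathematicalPhysics.QuantumFieldTheory.Balaban1983to89.B1Eq324BenfattoSect5LegGeometry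
  (le_l1_core_sdiff_frame4_of_not_mem_core not_mem_core_of_mem_frame1_union_frame2)
open Literature.MathematicalPhysics.QuantumFieldTheory.Balaban1983to89.B1Eq324BenfattoSect5PerBoxAtPavement
  (classes_subset_box weightedMass_classes_le)
open Literature.MathematicalPhysics.QuantumFieldTheory.Balaban1983to89.B1Eq324BenfattoAppendixC2 (freeCov_nonneg)

variable {d : ℕ}

/-! ## §0  Tuple sums over set differences; cumulants of equal observables -/

section Basic

variable {α β : ℝ} {s D : ℕ} {κ : ℝ} {a : Coef d} {J : Finset (B1Eq324BenfattoLemma.Site d)}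

/-- A tuple-class sum over a difference of classes is the difference of the sums (`B_p ⊆ A_p`). [cite: BenfattoEtAl1978, (5.5)–(5.6) p.154] -/
theorem tupleSum_sdiff_eq {Acl Bcl : (p : ℕ) → Finset (Fin p → J)} (h : ∀ p, Bcl p ⊆ Acl p) (z : B1Eq324BenfattoLemma.Site d → ℝ) :
    ∑ p ∈ Finset.Icc 1 s, ∑ Δ ∈ Acl p \ Bcl p, ∑ n ∈ admissible p D, term κ a z p Δ n =
      (∑ p ∈ Finset.Icc 1 s, ∑ Δ ∈ Acl p, ∑ n ∈ admissible p D, term κ a z p Δ n)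
        - ∑ p ∈ Finset.Icc 1 s, ∑ Δ ∈ Bcl p, ∑ n ∈ admissible p D, term κ a z p Δ n := by
  rw [← Finset.sum_sub_distrib]
  refine Finset.sum_congr rfl fun p _ => ?_
  rw [Finset.sum_sdiff_eq_sub (h p)]

/-- Free truncated expectations of pointwise-equal observables agree. [cite: BenfattoEtAl1978, (2.7) p.147] -/
theorem truncatedExp_congr (μ : Measure (B1Eq324BenfattoLemma.Site d → ℝ)) {H H' : (B1Eq324BenfattoLemma.Site d → ℝ) → ℝ}
    (h : ∀ z, H z = H' z) (k : ℕ) : truncatedExp μ H k = truncatedExp μ H' k := by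
  have : H = H' := funext h
  rw [this]

/-- The lattice-sum constants `Σ_{p≤s}#adm(p,D)·((2/(1−e^{−c/p√d}))e^{c/p√d})^{d(p−1)}` are non-negative (`c ≥ 0`).
[cite: BenfattoEtAl1978, (5.11) p.155, (5.29) p.157] -/
theorem latticeSumConst_nonneg {c : ℝ} (hc : 0 ≤ c) :
    0 ≤ ∑ p ∈ Finset.Icc 1 s, ((admissible p D).card : ℝ) *
      ((2 / (1 - Real.exp (-(c / (p : ℕ) / Real.sqrt d))) * Real.exp (c / (p : ℕ) / Real.sqrt d)) ^ d) ^ (p - 1) := by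
  refine Finset.sum_nonneg fun p _ => mul_nonneg (Nat.cast_nonneg _) (pow_nonneg (pow_nonneg (mul_nonneg ?_ (Real.exp_pos _).le) _) _)
  refine div_nonneg (by norm_num) ?_
  have hx : 0 ≤ c / (p : ℕ) / Real.sqrt d := by positivity
  have : Real.exp (-(c / (p : ℕ) / Real.sqrt d)) ≤ 1 := Real.exp_le_one_iff.mpr (by linarith)
  linarith

end Basic

/-! ## §1  «H_J vs X»: `X = H_{Γ₁} + Σ_□(Ψ₁+Ψ₂)(□) = Ĥ_J − Σ_□Ψ₃(□)` as the class `hatTuples ∖ ⋃_□Ψ₃cls(□)` -/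

section HX

variable {α β : ℝ} {s D : ℕ} {κ : ℝ} {a : Coef d} {J : Finset (B1Eq324BenfattoLemma.Site d)} {L w v : ℕ}
  {B : Finset (B1Eq324BenfattoLemma.Site d)}

/-- **The `Ψ₃` classes lie among the tuples of `Ĥ_J`**: a tuple crossing `□′|Γ₂(□)` lies inside `□′ ∪ Γ₂(□) = shrink w`, one of `Ĥ_J`'s box classes.
[cite: BenfattoEtAl1978, (5.9) p.155, (5.23) p.157] -/
theorem psi3Class_subset_hatTuples (p : ℕ) :
    (B.biUnion fun m => crossT J p (core L w m) (frame2 L w m) \ crossT J p (core L w m) (frame3 L w v m)) ⊆ hatTuples J p L w B := by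
  intro Δ hΔ
  obtain ⟨m, hm, hΔm⟩ := Finset.mem_biUnion.1 hΔ
  rw [hatTuples]
  refine Finset.mem_union_right _ (Finset.mem_biUnion.2 ⟨m, hm, Finset.mem_union_left _ ?_⟩)
  rw [mem_tuplesIn]
  intro i
  have h := (mem_crossT.1 (Finset.mem_sdiff.1 hΔm).1).1 i
  rw [core_union_frame2] at h
  exact h

/-- **`X = H_{Γ₁} + Σ_□(Ψ₁+Ψ₂)(□)` IS ONE TUPLE-CLASS SUM**, over `hatTuples ∖ ⋃_□Ψ₃cls(□)`: `X = Ĥ_J − Σ_□Ψ₃(□)` ((5.9), (5.23)), `Ĥ_J` is the sum over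
`hatTuples` (`…HlCumulants.hatH_eq_tupleSum`) and `Σ_□Ψ₃(□)` the sum over the `Ψ₃` classes (`…Psi3Cumulants.tupleSum_psi3Class_eq_sum_psi3`).
[cite: BenfattoEtAl1978, (5.9) p.155, (5.23) p.157] -/
theorem X_eq_tupleSum (hJ : CoefSupportedIn a J) (hL : 0 < L) (hv : v ≤ w) (z : B1Eq324BenfattoLemma.Site d → ℝ) :
    hamiltonian s D κ a (corridors L w B) z + ∑ m ∈ B, (psi1 s D κ a L w v m z + psi2 s D κ a L w m z) =
      ∑ p ∈ Finset.Icc 1 s, ∑ Δ ∈ hatTuples J p L w B \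
          B.biUnion (fun m => crossT J p (core L w m) (frame2 L w m) \ crossT J p (core L w m) (frame3 L w v m)),
        ∑ n ∈ admissible p D, term κ a z p Δ n := by
  rw [tupleSum_sdiff_eq (fun p => psi3Class_subset_hatTuples p), ← hatH_eq_tupleSum hJ hL w z,
    tupleSum_psi3Class_eq_sum_psi3 hL hJ hv z, hatH]
  have h : ∀ m ∈ B, psiBox s D κ a L w m z = psi1 s D κ a L w v m z + psi2 s D κ a L w m z + psi3 s D κ a L w v m z :=
    fun m _ => psiBox_eq_psi1_add_psi2_add_psi3 s D κ a L w v m z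
  rw [Finset.sum_congr rfl h]
  simp only [Finset.sum_add_distrib]
  ring

/-- `Ĥ_J = X-class sum + Ψ₃-class sum`, pointwise. [cite: BenfattoEtAl1978, (5.9) p.155, (5.23) p.157] -/
theorem hatH_eq_X_add_psi3Sum (hJ : CoefSupportedIn a J) (hL : 0 < L) (z : B1Eq324BenfattoLemma.Site d → ℝ) :
    hatH s D κ a L w B z =
      (∑ p ∈ Finset.Icc 1 s, ∑ Δ ∈ hatTuples J p L w B \
          B.biUnion (fun m => crossT J p (core L w m) (frame2 L w m) \ crossT J p (core L w m) (frame3 L w v m)),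
        ∑ n ∈ admissible p D, term κ a z p Δ n)
      + ∑ p ∈ Finset.Icc 1 s, ∑ Δ ∈ B.biUnion (fun m =>
          crossT J p (core L w m) (frame2 L w m) \ crossT J p (core L w m) (frame3 L w v m)), ∑ n ∈ admissible p D, term κ a z p Δ n := by
  rw [tupleSum_sdiff_eq (fun p => psi3Class_subset_hatTuples p), sub_add_cancel, hatH_eq_tupleSum hJ hL w z]

/-- **«H_J vs X» — (5.11) AND (5.24) INSIDE THE FREE CUMULANTS**: for every order `k+1`,
`|Ê₀^T(H_J;k+1) − Ê₀^T(X;k+1)| ≤ [(5.11) in cumulants: …HlCumulants] + [Ψ₃-removal: …Psi3Cumulants at T_X := hatTuples ∖ Ψ₃cls]` — both EXTENSIVE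
(`∝ |J|` resp. `∝ |B|·L^d`) and exponentially small in the corridor widths (`e^{−(c/2)w}`, `e^{−(c/2)v}`, `c = ϰ/2 − (δ/2)D²√d`).
[cite: BenfattoEtAl1978, (5.11) p.155, (5.24) p.157, (5.31)–(5.35) pp.158–159] -/
theorem abs_truncatedExp_hamiltonian_sub_X_le (hα : 0 < α) (hβ : 0 < β) (hd : 0 < d) (hJ : CoefSupportedIn a J) {A : ℝ}
    (hA0 : 0 ≤ A) (hA : ∀ (p : ℕ) (Δ : Fin p → B1Eq324BenfattoLemma.Site d) (n : Fin p → ℕ), |a p Δ n| ≤ A)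
    (hL : 0 < L) (hB : J.image (boxIndex L) ⊆ B) (hv : v ≤ w) {δ : ℝ} (hδ : 0 < δ) (hδle : δ ≤ Real.log ((2 * d + α ^ 2) / (2 * d)))
    (hres : 0 < κ / 2 - δ / 2 * ((D : ℝ) ^ 2 * Real.sqrt d)) (k : ℕ) :
    |truncatedExp (P0 d α β) (hamiltonian s D κ a J) (k + 1)
        - truncatedExp (P0 d α β)
            (fun z => hamiltonian s D κ a (corridors L w B) z + ∑ m ∈ B, (psi1 s D κ a L w v m z + psi2 s D κ a L w m z)) (k + 1)| ≤
      2 ^ (k + 1) * (2 ^ ((k + 1) * D) * 2 ^ 2 ^ ((k + 1) * D) * (max 1 (freeCov d α β 0 0)) ^ ((k + 1) * D)) *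
          ((A * Real.exp (δ / 2 * ((D : ℝ) ^ 2 * d)) *
              Real.exp (-((κ / 2 - δ / 2 * ((D : ℝ) ^ 2 * Real.sqrt d)) / 2 * w))) * J.card *
            ∑ p ∈ Finset.Icc 1 s, ((admissible p D).card : ℝ) *
              ((2 / (1 - Real.exp (-((κ / 2 - δ / 2 * ((D : ℝ) ^ 2 * Real.sqrt d)) / 2 / (p : ℕ) / Real.sqrt d))) *
                Real.exp ((κ / 2 - δ / 2 * ((D : ℝ) ^ 2 * Real.sqrt d)) / 2 / (p : ℕ) / Real.sqrt d)) ^ d) ^ (p - 1)) *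
          (A * Real.exp (δ / 2 * ((D : ℝ) ^ 2 * d)) *
            ((1 : ℝ) * (2 / (1 - Real.exp (-(δ / (2 * ((k + 1 : ℕ) : ℝ)) / Real.sqrt d))) *
              Real.exp (δ / (2 * ((k + 1 : ℕ) : ℝ)) / Real.sqrt d)) ^ d) *
            ∑ p ∈ Finset.Icc 1 s, ((admissible p D).card : ℝ) *
              ((2 / (1 - Real.exp (-((κ / 2 - δ / 2 * ((D : ℝ) ^ 2 * Real.sqrt d)) / (p : ℕ) / Real.sqrt d))) *
                Real.exp ((κ / 2 - δ / 2 * ((D : ℝ) ^ 2 * Real.sqrt d)) / (p : ℕ) / Real.sqrt d)) ^ d) ^ (p - 1)) ^ k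
      + 2 ^ (k + 1) * (2 ^ ((k + 1) * D) * 2 ^ 2 ^ ((k + 1) * D) * (max 1 (freeCov d α β 0 0)) ^ ((k + 1) * D)) *
        (B.card * (A * Real.exp (δ / 2 * ((D : ℝ) ^ 2 * d)) * Real.exp (-((κ / 2 - δ / 2 * ((D : ℝ) ^ 2 * Real.sqrt d)) / 2 * v)) *
          (L : ℝ) ^ d * ∑ p ∈ Finset.Icc 1 s, ((admissible p D).card : ℝ) *
            ((2 / (1 - Real.exp (-((κ / 2 - δ / 2 * ((D : ℝ) ^ 2 * Real.sqrt d)) / 2 / (p : ℕ) / Real.sqrt d))) *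
              Real.exp ((κ / 2 - δ / 2 * ((D : ℝ) ^ 2 * Real.sqrt d)) / 2 / (p : ℕ) / Real.sqrt d)) ^ d) ^ (p - 1))) *
        (A * Real.exp (δ / 2 * ((D : ℝ) ^ 2 * d)) *
          (2 / (1 - Real.exp (-(δ / (2 * ((k + 1 : ℕ) : ℝ)) / Real.sqrt d))) * Real.exp (δ / (2 * ((k + 1 : ℕ) : ℝ)) / Real.sqrt d)) ^ d *
          ∑ p ∈ Finset.Icc 1 s, ((admissible p D).card : ℝ) *
            ((2 / (1 - Real.exp (-((κ / 2 - δ / 2 * ((D : ℝ) ^ 2 * Real.sqrt d)) / (p : ℕ) / Real.sqrt d))) *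
              Real.exp ((κ / 2 - δ / 2 * ((D : ℝ) ^ 2 * Real.sqrt d)) / (p : ℕ) / Real.sqrt d)) ^ d) ^ (p - 1)) ^ k := by
  have hδκ : δ * ((D : ℝ) ^ 2 * Real.sqrt d) < κ := by linarith
  have hv2 : v ≤ 2 * w := hv.trans (Nat.le_mul_of_pos_left w two_pos)
  -- (5.11) in cumulants
  have h1 := abs_truncatedExp_hamiltonian_sub_hatH_le (s := s) (D := D) (ϰ := κ) hα hβ hd hJ hA0 hA hL hB hδ hδle hδκ w k
  -- Ψ₃-removal at `T_X := hatTuples ∖ Ψ₃cls`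
  have h2 := abs_cumulantOf_add_psi3_sub_le (s := s) (D := D) (κ := κ) (J := J) (L := L) (w := w) (v := v) (B := B) hα hβ hd hres hδ
    hδle hA0 hA hv2
    (fun p => hatTuples J p L w B \ B.biUnion (fun m => crossT J p (core L w m) (frame2 L w m) \ crossT J p (core L w m) (frame3 L w v m))) k
  -- the two cumulants of `h2` are `T₀(Ĥ_J)` and `T₀(X)`
  have hhat : truncatedExp (P0 d α β) (hatH s D κ a L w B) (k + 1) =
      cumulantOf (fun r => ∫ z, ((∑ p ∈ Finset.Icc 1 s, ∑ Δ ∈ hatTuples J p L w B \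
          B.biUnion (fun m => crossT J p (core L w m) (frame2 L w m) \ crossT J p (core L w m) (frame3 L w v m)),
            ∑ n ∈ admissible p D, term κ a z p Δ n) +
          (∑ p ∈ Finset.Icc 1 s, ∑ Δ ∈ B.biUnion (fun m =>
            crossT J p (core L w m) (frame2 L w m) \ crossT J p (core L w m) (frame3 L w v m)),
            ∑ n ∈ admissible p D, term κ a z p Δ n)) ^ r ∂P0 d α β) (k + 1) := by
    unfold truncatedExp
    congr 1
    funext r
    refine integral_congr_ae (ae_of_all _ fun z => ?_)
    dsimp only
    rw [hatH_eq_X_add_psi3Sum hJ hL z (v := v)]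
  have hX : truncatedExp (P0 d α β)
        (fun z => hamiltonian s D κ a (corridors L w B) z + ∑ m ∈ B, (psi1 s D κ a L w v m z + psi2 s D κ a L w m z)) (k + 1) =
      cumulantOf (fun r => ∫ z, (∑ p ∈ Finset.Icc 1 s, ∑ Δ ∈ hatTuples J p L w B \
          B.biUnion (fun m => crossT J p (core L w m) (frame2 L w m) \ crossT J p (core L w m) (frame3 L w v m)),
            ∑ n ∈ admissible p D, term κ a z p Δ n) ^ r ∂P0 d α β) (k + 1) := by
    unfold truncatedExp
    congr 1
    funext r
    refine integral_congr_ae (ae_of_all _ fun z => ?_)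
    dsimp only
    rw [X_eq_tupleSum hJ hL hv z]
  rw [← hhat, ← hX] at h2
  have htri := abs_sub_le (truncatedExp (P0 d α β) (hamiltonian s D κ a J) (k + 1))
    (truncatedExp (P0 d α β) (hatH s D κ a L w B) (k + 1))
    (truncatedExp (P0 d α β)
      (fun z => hamiltonian s D κ a (corridors L w B) z + ∑ m ∈ B, (psi1 s D κ a L w v m z + psi2 s D κ a L w m z)) (k + 1))
  linarith

end HX

/-! ## §2  «H_{Γ̄₁} vs Y»: `Y + Σ_□corr(□)` is the class `hatTuplesBar`, `Y` the class `hatTuplesBar ∖ ⋃_□corrCls(□)` -/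

section HY

variable {α β : ℝ} {s D : ℕ} {κ : ℝ} {a : Coef d} {J : Finset (B1Eq324BenfattoLemma.Site d)} {L w v : ℕ}
  {B : Finset (B1Eq324BenfattoLemma.Site d)}

/-- **The (5.33) correction classes lie among the tuples of `hatTuplesBar`**: a tuple crossing `Γ₄(□)|Γ₂(□)` lies inside `Γ₂(□) ∪ Γ₄(□)`.
[cite: BenfattoEtAl1978, (5.33)–(5.34) p.159] -/
theorem corrClass_subset_hatTuplesBar (p : ℕ) :
    (B.biUnion fun m => crossT J p (frame4 L w v m) (frame2 L w m) \ crossT J p (frame4 L w v m) (frame3 L w v m)) ⊆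
      hatTuplesBar J p L w v B := by
  intro Δ hΔ
  obtain ⟨m, hm, hΔm⟩ := Finset.mem_biUnion.1 hΔ
  rw [hatTuplesBar]
  refine Finset.mem_union_right _ (Finset.mem_biUnion.2 ⟨m, hm, Finset.mem_union_left _ ?_⟩)
  rw [mem_tuplesIn]
  intro i
  have h := (mem_crossT.1 (Finset.mem_sdiff.1 hΔm).1).1 i
  rw [Finset.union_comm] at h
  exact h

/-- **`H_{Γ̄₁} = (hatTuplesBar-sum) + (remainder-sum)`**, pointwise (`…Eq534.hatTuplesBar_subset`, `hamiltonian_eq_sum_tuplesIn`).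
[cite: BenfattoEtAl1978, (5.34) p.159] -/
theorem hamiltonian_corridorsBar_eq_tupleSum_add_rem (hJ : CoefSupportedIn a J) (z : B1Eq324BenfattoLemma.Site d → ℝ) :
    hamiltonian s D κ a (corridorsBar L w v B) z =
      (∑ p ∈ Finset.Icc 1 s, ∑ Δ ∈ hatTuplesBar J p L w v B, ∑ n ∈ admissible p D, term κ a z p Δ n)
      + ∑ p ∈ Finset.Icc 1 s, ∑ Δ ∈ tuplesIn J p (corridorsBar L w v B) \ hatTuplesBar J p L w v B,
          ∑ n ∈ admissible p D, term κ a z p Δ n := by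
  rw [tupleSum_sdiff_eq (fun p => (hatTuplesBar_subset : hatTuplesBar J p L w v B ⊆ _)), add_sub_cancel,
    hamiltonian_eq_sum_tuplesIn hJ]

/-- **`Y + Σ_□corr(□) = H_{Γ₁} + Σ_□(Ψ′₁+Ψ₂)(□) + Σ_□(H_{Γ₄,Γ₂} − H_{Γ₄,Γ₃})(□)` IS THE CLASS `hatTuplesBar`** ((5.33)–(5.34): `…Eq534.hamiltonian_corridorsBar_eq`,
`psi1p_add_psi2_eq`). [cite: BenfattoEtAl1978, (5.33)–(5.34) p.159] -/
theorem Y_add_corr_eq_tupleSum (hJ : CoefSupportedIn a J) (hL : 0 < L) (z : B1Eq324BenfattoLemma.Site d → ℝ) :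
    hamiltonian s D κ a (corridors L w B) z + ∑ m ∈ B, (psi1p s D κ a L w v m z + psi2 s D κ a L w m z)
      + ∑ m ∈ B, (interaction s D κ a (frame4 L w v m) (frame2 L w m) z - interaction s D κ a (frame4 L w v m) (frame3 L w v m) z) =
      ∑ p ∈ Finset.Icc 1 s, ∑ Δ ∈ hatTuplesBar J p L w v B, ∑ n ∈ admissible p D, term κ a z p Δ n := by
  have h534 := hamiltonian_corridorsBar_eq (s := s) (D := D) (κ := κ) (w := w) (v := v) (B := B) hJ hL z
  have hrem := hamiltonian_corridorsBar_eq_tupleSum_add_rem (s := s) (D := D) (κ := κ) (L := L) (w := w) (v := v) (B := B) hJ z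
  have hpsi : ∀ m ∈ B, psi1p s D κ a L w v m z + psi2 s D κ a L w m z =
      hamiltonian s D κ a (frame2 L w m ∪ frame4 L w v m) z + interaction s D κ a (frame2 L w m) (frame1 L w m) z
        - (interaction s D κ a (frame4 L w v m) (frame2 L w m) z - interaction s D κ a (frame4 L w v m) (frame3 L w v m) z) :=
    fun m _ => psi1p_add_psi2_eq s D κ a L w v m z
  rw [Finset.sum_congr rfl hpsi, Finset.sum_sub_distrib]
  linarith

/-- **`Y = H_{Γ₁} + Σ_□(Ψ′₁+Ψ₂)(□)` IS ONE TUPLE-CLASS SUM**, over `hatTuplesBar ∖ ⋃_□corrCls(□)` (`…Eq534Cumulants.tupleSum_corrClass_eq_sum`).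
[cite: BenfattoEtAl1978, (5.33)–(5.34) p.159] -/
theorem Y_eq_tupleSum (hJ : CoefSupportedIn a J) (hL : 0 < L) (hv : v ≤ w) (z : B1Eq324BenfattoLemma.Site d → ℝ) :
    hamiltonian s D κ a (corridors L w B) z + ∑ m ∈ B, (psi1p s D κ a L w v m z + psi2 s D κ a L w m z) =
      ∑ p ∈ Finset.Icc 1 s, ∑ Δ ∈ hatTuplesBar J p L w v B \
          B.biUnion (fun m => crossT J p (frame4 L w v m) (frame2 L w m) \ crossT J p (frame4 L w v m) (frame3 L w v m)),
        ∑ n ∈ admissible p D, term κ a z p Δ n := by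
  rw [tupleSum_sdiff_eq (fun p => corrClass_subset_hatTuplesBar p), ← Y_add_corr_eq_tupleSum hJ hL z (v := v),
    tupleSum_corrClass_eq_sum hL hJ hv z]
  ring

/-- **«H_{Γ̄₁} vs Y» — (5.33) AND (5.34) INSIDE THE FREE CUMULANTS**: for every order `k+1`,
`|Ê₀^T(H_{Γ̄₁};k+1) − Ê₀^T(Y;k+1)| ≤ [remainder: …Eq534Cumulants at T_X := hatTuplesBar] + [correction: at T_X := hatTuplesBar ∖ corrCls]` — EXTENSIVE
(`∝ |Γ̄₁|` resp. `∝ |B|·L^d`) and exponentially small (`e^{−(c/2)w}`, `e^{−(c/2)v}`). [cite: BenfattoEtAl1978, (5.33)–(5.35) p.159] -/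
theorem abs_truncatedExp_corridorsBar_sub_Y_le (hα : 0 < α) (hβ : 0 < β) (hd : 0 < d) (hJ : CoefSupportedIn a J) {A : ℝ}
    (hA0 : 0 ≤ A) (hA : ∀ (p : ℕ) (Δ : Fin p → B1Eq324BenfattoLemma.Site d) (n : Fin p → ℕ), |a p Δ n| ≤ A)
    (hL : 0 < L) (hv : v ≤ w) {δ : ℝ} (hδ : 0 < δ) (hδle : δ ≤ Real.log ((2 * d + α ^ 2) / (2 * d)))
    (hres : 0 < κ / 2 - δ / 2 * ((D : ℝ) ^ 2 * Real.sqrt d)) (k : ℕ) :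
    |truncatedExp (P0 d α β) (hamiltonian s D κ a (corridorsBar L w v B)) (k + 1)
        - truncatedExp (P0 d α β)
            (fun z => hamiltonian s D κ a (corridors L w B) z + ∑ m ∈ B, (psi1p s D κ a L w v m z + psi2 s D κ a L w m z)) (k + 1)| ≤
      2 ^ (k + 1) * (2 ^ ((k + 1) * D) * 2 ^ 2 ^ ((k + 1) * D) * (max 1 (freeCov d α β 0 0)) ^ ((k + 1) * D)) *
          (A * Real.exp (δ / 2 * ((D : ℝ) ^ 2 * d)) * Real.exp (-((κ / 2 - δ / 2 * ((D : ℝ) ^ 2 * Real.sqrt d)) / 2 * w)) *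
            (corridorsBar L w v B).card * ∑ p ∈ Finset.Icc 1 s, ((admissible p D).card : ℝ) *
              ((2 / (1 - Real.exp (-((κ / 2 - δ / 2 * ((D : ℝ) ^ 2 * Real.sqrt d)) / 2 / (p : ℕ) / Real.sqrt d))) *
                Real.exp ((κ / 2 - δ / 2 * ((D : ℝ) ^ 2 * Real.sqrt d)) / 2 / (p : ℕ) / Real.sqrt d)) ^ d) ^ (p - 1)) *
          (A * Real.exp (δ / 2 * ((D : ℝ) ^ 2 * d)) *
            (2 / (1 - Real.exp (-(δ / (2 * ((k + 1 : ℕ) : ℝ)) / Real.sqrt d))) * Real.exp (δ / (2 * ((k + 1 : ℕ) : ℝ)) / Real.sqrt d)) ^ d *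
            ∑ p ∈ Finset.Icc 1 s, ((admissible p D).card : ℝ) *
              ((2 / (1 - Real.exp (-((κ / 2 - δ / 2 * ((D : ℝ) ^ 2 * Real.sqrt d)) / (p : ℕ) / Real.sqrt d))) *
                Real.exp ((κ / 2 - δ / 2 * ((D : ℝ) ^ 2 * Real.sqrt d)) / (p : ℕ) / Real.sqrt d)) ^ d) ^ (p - 1)) ^ k
      + 2 ^ (k + 1) * (2 ^ ((k + 1) * D) * 2 ^ 2 ^ ((k + 1) * D) * (max 1 (freeCov d α β 0 0)) ^ ((k + 1) * D)) *
        (B.card * (A * Real.exp (δ / 2 * ((D : ℝ) ^ 2 * d)) * Real.exp (-((κ / 2 - δ / 2 * ((D : ℝ) ^ 2 * Real.sqrt d)) / 2 * v)) *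
          (L : ℝ) ^ d * ∑ p ∈ Finset.Icc 1 s, ((admissible p D).card : ℝ) *
            ((2 / (1 - Real.exp (-((κ / 2 - δ / 2 * ((D : ℝ) ^ 2 * Real.sqrt d)) / 2 / (p : ℕ) / Real.sqrt d))) *
              Real.exp ((κ / 2 - δ / 2 * ((D : ℝ) ^ 2 * Real.sqrt d)) / 2 / (p : ℕ) / Real.sqrt d)) ^ d) ^ (p - 1))) *
        (A * Real.exp (δ / 2 * ((D : ℝ) ^ 2 * d)) *
          (2 / (1 - Real.exp (-(δ / (2 * ((k + 1 : ℕ) : ℝ)) / Real.sqrt d))) * Real.exp (δ / (2 * ((k + 1 : ℕ) : ℝ)) / Real.sqrt d)) ^ d *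
          ∑ p ∈ Finset.Icc 1 s, ((admissible p D).card : ℝ) *
            ((2 / (1 - Real.exp (-((κ / 2 - δ / 2 * ((D : ℝ) ^ 2 * Real.sqrt d)) / (p : ℕ) / Real.sqrt d))) *
              Real.exp ((κ / 2 - δ / 2 * ((D : ℝ) ^ 2 * Real.sqrt d)) / (p : ℕ) / Real.sqrt d)) ^ d) ^ (p - 1)) ^ k := by
  have hv2 : v ≤ 2 * w := hv.trans (Nat.le_mul_of_pos_left w two_pos)
  -- remainder at `T_X := hatTuplesBar`
  have h1 := abs_cumulantOf_add_remainder_sub_le (s := s) (D := D) (κ := κ) (J := J) (L := L) (w := w) (v := v) (B := B) hα hβ hd hL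
    hres hδ hδle hA0 hA (fun p => hatTuplesBar J p L w v B) k
  -- correction at `T_X := hatTuplesBar ∖ corrCls`
  have h2 := abs_cumulantOf_add_corr_sub_le (s := s) (D := D) (κ := κ) (J := J) (L := L) (w := w) (v := v) (B := B) hα hβ hd hres hδ
    hδle hA0 hA hv2
    (fun p => hatTuplesBar J p L w v B \
      B.biUnion (fun m => crossT J p (frame4 L w v m) (frame2 L w m) \ crossT J p (frame4 L w v m) (frame3 L w v m))) k
  -- identify the cumulants
  have hH : truncatedExp (P0 d α β) (hamiltonian s D κ a (corridorsBar L w v B)) (k + 1) =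
      cumulantOf (fun r => ∫ z, ((∑ p ∈ Finset.Icc 1 s, ∑ Δ ∈ hatTuplesBar J p L w v B, ∑ n ∈ admissible p D, term κ a z p Δ n) +
          (∑ p ∈ Finset.Icc 1 s, ∑ Δ ∈ tuplesIn J p (corridorsBar L w v B) \ hatTuplesBar J p L w v B,
            ∑ n ∈ admissible p D, term κ a z p Δ n)) ^ r ∂P0 d α β) (k + 1) := by
    unfold truncatedExp
    congr 1
    funext r
    refine integral_congr_ae (ae_of_all _ fun z => ?_)
    dsimp only
    rw [hamiltonian_corridorsBar_eq_tupleSum_add_rem hJ z]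
  have hmid : cumulantOf (fun r => ∫ z, ((∑ p ∈ Finset.Icc 1 s, ∑ Δ ∈ hatTuplesBar J p L w v B \
          B.biUnion (fun m => crossT J p (frame4 L w v m) (frame2 L w m) \ crossT J p (frame4 L w v m) (frame3 L w v m)),
            ∑ n ∈ admissible p D, term κ a z p Δ n) +
          (∑ p ∈ Finset.Icc 1 s, ∑ Δ ∈ B.biUnion (fun m =>
            crossT J p (frame4 L w v m) (frame2 L w m) \ crossT J p (frame4 L w v m) (frame3 L w v m)),
            ∑ n ∈ admissible p D, term κ a z p Δ n)) ^ r ∂P0 d α β) (k + 1) =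
      cumulantOf (fun r => ∫ z, (∑ p ∈ Finset.Icc 1 s, ∑ Δ ∈ hatTuplesBar J p L w v B, ∑ n ∈ admissible p D, term κ a z p Δ n) ^ r
        ∂P0 d α β) (k + 1) := by
    congr 1
    funext r
    refine integral_congr_ae (ae_of_all _ fun z => ?_)
    dsimp only
    rw [tupleSum_sdiff_eq (fun p => corrClass_subset_hatTuplesBar p), sub_add_cancel]
  have hY : truncatedExp (P0 d α β)
        (fun z => hamiltonian s D κ a (corridors L w B) z + ∑ m ∈ B, (psi1p s D κ a L w v m z + psi2 s D κ a L w m z)) (k + 1) =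
      cumulantOf (fun r => ∫ z, (∑ p ∈ Finset.Icc 1 s, ∑ Δ ∈ hatTuplesBar J p L w v B \
          B.biUnion (fun m => crossT J p (frame4 L w v m) (frame2 L w m) \ crossT J p (frame4 L w v m) (frame3 L w v m)),
            ∑ n ∈ admissible p D, term κ a z p Δ n) ^ r ∂P0 d α β) (k + 1) := by
    unfold truncatedExp
    congr 1
    funext r
    refine integral_congr_ae (ae_of_all _ fun z => ?_)
    dsimp only
    rw [Y_eq_tupleSum hJ hL hv z]
  rw [← hH] at h1
  rw [hmid, ← hY] at h2
  have htri := abs_sub_le (truncatedExp (P0 d α β) (hamiltonian s D κ a (corridorsBar L w v B)) (k + 1))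
    (cumulantOf (fun r => ∫ z, (∑ p ∈ Finset.Icc 1 s, ∑ Δ ∈ hatTuplesBar J p L w v B, ∑ n ∈ admissible p D, term κ a z p Δ n) ^ r
        ∂P0 d α β) (k + 1))
    (truncatedExp (P0 d α β)
      (fun z => hamiltonian s D κ a (corridors L w B) z + ∑ m ∈ B, (psi1p s D κ a L w v m z + psi2 s D κ a L w m z)) (k + 1))
  linarith

end HY

/-! ## §3  «W₂₉ under P̂₀»: the within-box (5.29)-type colourings of the free side, Appendix D at `Γ = ∅` -/

section W29

variable {α β : ℝ} {s D : ℕ} {κ : ℝ} {a : Coef d} {J : Finset (B1Eq324BenfattoLemma.Site d)} {L w v : ℕ}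
  {B : Finset (B1Eq324BenfattoLemma.Site d)}

/-- The three slots `Ψ′₁, Ψ″₁, Ψ₂` of box `□_m` as tuple-class sums over the explicit triple of classes. [cite: BenfattoEtAl1978, (5.23)–(5.27) p.157] -/
theorem slot_eq_tupleSum (hJ : CoefSupportedIn a J) (m : B1Eq324BenfattoLemma.Site d) (c : Fin 3) (z : B1Eq324BenfattoLemma.Site d → ℝ) :
    (![fun z => psi1p s D κ a L w v m z, fun z => psi1pp s D κ a L w v m z, fun z => psi2 s D κ a L w m z] :
        Fin 3 → (B1Eq324BenfattoLemma.Site d → ℝ) → ℝ) c z =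
      ∑ p ∈ Finset.Icc 1 s, ∑ Δ ∈ (![fun p => tuplesIn J p (frame4 L w v m) ∪ crossT J p (frame4 L w v m) (frame3 L w v m),
          fun p => (tuplesIn J p (core L w m) \ tuplesIn J p (frame4 L w v m)) ∪
            (crossT J p (core L w m) (frame3 L w v m) \ crossT J p (frame4 L w v m) (frame3 L w v m)),
          fun p => crossT J p (frame1 L w m) (frame2 L w m) ∪ tuplesIn J p (frame2 L w m)] :
            Fin 3 → (p : ℕ) → Finset (Fin p → J)) c p, ∑ n ∈ admissible p D, term κ a z p Δ n := by
  fin_cases c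
  · exact psi1p_eq_tupleSum hJ z
  · exact psi1pp_eq_tupleSum hJ z
  · exact psi2_eq_tupleSum hJ z

/-- **ONE WITHIN-BOX (5.29)-TYPE COLOURING UNDER `P̂₀` IS SMALL** — Appendix D at `Γ = ∅` (`P̂₀ = condField ∅`, centre `u = 0`): for a colouring `f` of
`k+1` slots by `Ψ′₁(□), Ψ″₁(□), Ψ₂(□)` using `Ψ″₁` AND `Ψ₂`,
`|𝓔^T_{P̂₀}(f)| ≤ 2^{(k+1)D}2^{2^{(k+1)D}}K₀^{(k+1)D}·e^{−(δ/2)(v+1)}·M̃(□)^{k+1}`, `K₀ = max(1, C₀₀)`, `M̃(□)` the `δ`-inflated mass bound of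
`…PerBoxAtPavement.weightedMass_classes_le` — every `Ψ″₁`-tuple meets `□′∖Γ₄(□)`, every `Ψ₂`-tuple lies in `Γ₁(□)∪Γ₂(□)`, at `ℓ¹`-distance `≥ v+1`
(the geometry of `…PerBoxAppD`). [cite: BenfattoEtAl1978, (5.29) p.157, Appendix D p.166] -/
theorem abs_W29_le (hα : 0 < α) (hβ : 0 < β) (hd : 0 < d) (hJ : CoefSupportedIn a J) {A : ℝ} (hA0 : 0 ≤ A)
    (hA : ∀ (p : ℕ) (Δ : Fin p → B1Eq324BenfattoLemma.Site d) (n : Fin p → ℕ), |a p Δ n| ≤ A) (hv : v ≤ w)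
    {δ : ℝ} (hδ0 : 0 ≤ δ) (hδle : δ ≤ Real.log ((2 * d + α ^ 2) / (2 * d))) (hres : 0 < κ / 2 - δ / 2 * ((D : ℝ) ^ 2 * Real.sqrt d))
    (m : B1Eq324BenfattoLemma.Site d) (k : ℕ) (f : Fin (k + 1) → Fin 3) (h1 : ∃ j, f j = 1) (h2 : ∃ j, f j = 2) :
    |ursellOf (fun P : Finset (Fin (k + 1)) => ∫ z, ∏ j ∈ P,
        (![fun z => psi1p s D κ a L w v m z, fun z => psi1pp s D κ a L w v m z, fun z => psi2 s D κ a L w m z] (f j)) z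
          ∂P0 d α β) univ| ≤
      2 ^ ((k + 1) * D) * 2 ^ 2 ^ ((k + 1) * D) * (max 1 (freeCov d α β 0 0)) ^ ((k + 1) * D) *
          Real.exp (-(δ / 2 * ((v : ℝ) + 1))) *
        (A * Real.exp (δ / 2 * ((D : ℝ) ^ 2 * d)) * (L : ℝ) ^ d * ∑ p ∈ Finset.Icc 1 s, ((admissible p D).card : ℝ) *
          ((2 / (1 - Real.exp (-((κ / 2 - δ / 2 * ((D : ℝ) ^ 2 * Real.sqrt d)) / (p : ℕ) / Real.sqrt d))) *
            Real.exp ((κ / 2 - δ / 2 * ((D : ℝ) ^ 2 * Real.sqrt d)) / (p : ℕ) / Real.sqrt d)) ^ d) ^ (p - 1)) ^ (k + 1) := by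
  set T : Fin 3 → (p : ℕ) → Finset (Fin p → J) :=
    ![fun p => tuplesIn J p (frame4 L w v m) ∪ crossT J p (frame4 L w v m) (frame3 L w v m),
      fun p => (tuplesIn J p (core L w m) \ tuplesIn J p (frame4 L w v m)) ∪
        (crossT J p (core L w m) (frame3 L w v m) \ crossT J p (frame4 L w v m) (frame3 L w v m)),
      fun p => crossT J p (frame1 L w m) (frame2 L w m) ∪ tuplesIn J p (frame2 L w m)] with hT
  set Mt : ℝ := A * Real.exp (δ / 2 * ((D : ℝ) ^ 2 * d)) * (L : ℝ) ^ d * ∑ p ∈ Finset.Icc 1 s, ((admissible p D).card : ℝ) *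
      ((2 / (1 - Real.exp (-((κ / 2 - δ / 2 * ((D : ℝ) ^ 2 * Real.sqrt d)) / (p : ℕ) / Real.sqrt d))) *
        Real.exp ((κ / 2 - δ / 2 * ((D : ℝ) ^ 2 * Real.sqrt d)) / (p : ℕ) / Real.sqrt d)) ^ d) ^ (p - 1) with hMt
  -- the slots as tuple-class sums, under `condField ∅ 0 = P̂₀`
  have hslots : (fun P : Finset (Fin (k + 1)) => ∫ z, ∏ j ∈ P,
        (![fun z => psi1p s D κ a L w v m z, fun z => psi1pp s D κ a L w v m z, fun z => psi2 s D κ a L w m z] (f j)) z ∂P0 d α β) =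
      fun P : Finset (Fin (k + 1)) => ∫ z, ∏ j ∈ P,
        (∑ p ∈ Finset.Icc 1 s, ∑ Δ ∈ T (f j) p, ∑ n ∈ admissible p D, term κ a z p Δ n)
          ∂condField d α β ∅ (fun _ => (0 : ℝ)) := by
    funext P
    rw [condField_empty]
    refine integral_congr_ae (ae_of_all _ fun z => ?_)
    exact Finset.prod_congr rfl fun j _ => slot_eq_tupleSum hJ m (f j) z
  rw [hslots]
  have hK₀1 : (1 : ℝ) ≤ max 1 (freeCov d α β 0 0) := le_max_left _ _
  have hK₀C : freeCov d α β 0 0 ≤ max 1 (freeCov d α β 0 0) := le_max_right _ _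
  have hK₀0 : (0 : ℝ) ≤ max 1 (freeCov d α β 0 0) := zero_le_one.trans hK₀1
  obtain ⟨j₁, hj₁⟩ := h1
  obtain ⟨j₂, hj₂⟩ := h2
  have h := Literature.MathematicalPhysics.QuantumFieldTheory.Balaban1983to89.B1Eq324BenfattoSect5TupleClusters.abs_ursellOf_tupleSums_condField_le_exp_of_separated
    (σ := Fin (k + 1)) (s := s) (D := D) (ϰ := κ) (a := a) hα hβ hd ∅ (fun _ => (0 : ℝ)) (fun j => T (f j)) hK₀1 hK₀C
    (fun j p _ Δ _ i => by rw [condMean_empty, abs_zero]; exact hK₀0) hδ0 hδle j₁ j₂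
    (shrink L m (2 * w + v) : Set (B1Eq324BenfattoLemma.Site d))
    (↑(frame1 L w m ∪ frame2 L w m) : Set (B1Eq324BenfattoLemma.Site d)) (ρ₀ := (v : ℝ) + 1)
    (fun p hp Δ hΔ => by
      rw [hj₁] at hΔ
      have hΔ' : Δ ∈ (tuplesIn J p (core L w m) \ tuplesIn J p (frame4 L w v m)) ∪
          (crossT J p (core L w m) (frame3 L w v m) \ crossT J p (frame4 L w v m) (frame3 L w v m)) := hΔ
      obtain ⟨i, hi⟩ := exists_mem_core_sdiff_frame4 hΔ'
      exact ⟨i, Finset.mem_coe.2 hi⟩)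
    (fun p hp Δ hΔ => by
      rw [hj₂] at hΔ
      have hΔ' : Δ ∈ crossT J p (frame1 L w m) (frame2 L w m) ∪ tuplesIn J p (frame2 L w m) := hΔ
      have hp1 : 1 ≤ p := (Finset.mem_Icc.1 hp).1
      refine ⟨⟨0, hp1⟩, Finset.mem_coe.2 ?_⟩
      rcases Finset.mem_union.1 hΔ' with h | h
      · exact (mem_crossT.1 h).1 _
      · exact Finset.mem_union_right _ ((mem_tuplesIn.1 h) _))
    (fun x hx y hy => by
      rw [Finset.mem_coe, ← core_sdiff_frame4] at hx
      exact le_l1_core_sdiff_frame4_of_not_mem_core hx (not_mem_core_of_mem_frame1_union_frame2 (Finset.mem_coe.1 hy)))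
  rw [Fintype.card_fin] at h
  refine h.trans ?_
  have happ : (0 : ℝ) ≤ 2 ^ ((k + 1) * D) * 2 ^ 2 ^ ((k + 1) * D) * (max 1 (freeCov d α β 0 0)) ^ ((k + 1) * D) :=
    mul_nonneg (mul_nonneg (pow_nonneg (by norm_num) _) (pow_nonneg (by norm_num) _)) (pow_nonneg hK₀0 _)
  refine mul_le_mul_of_nonneg_left ?_ (mul_nonneg happ (Real.exp_pos _).le)
  have hmass0 : ∀ c, 0 ≤ ∑ p ∈ Finset.Icc 1 s, ∑ Δ ∈ T c p, ∑ n ∈ admissible p D,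
      |a p (fun i => (Δ i : B1Eq324BenfattoLemma.Site d)) n| *
        Real.exp (-(κ / 2) * connLength fun i => (Δ i : B1Eq324BenfattoLemma.Site d)) *
        Real.exp (δ / 2 * ((D : ℝ) ^ 2 * (Real.sqrt d * connLength (fun i => (Δ i : B1Eq324BenfattoLemma.Site d)) + d))) :=
    fun c => Finset.sum_nonneg fun p _ => Finset.sum_nonneg fun Δ _ => Finset.sum_nonneg fun n _ =>
      mul_nonneg (mul_nonneg (abs_nonneg _) (Real.exp_pos _).le) (Real.exp_pos _).le
  have hMt' : ∀ c, ∑ p ∈ Finset.Icc 1 s, ∑ Δ ∈ T c p, ∑ n ∈ admissible p D,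
      |a p (fun i => (Δ i : B1Eq324BenfattoLemma.Site d)) n| *
        Real.exp (-(κ / 2) * connLength fun i => (Δ i : B1Eq324BenfattoLemma.Site d)) *
        Real.exp (δ / 2 * ((D : ℝ) ^ 2 * (Real.sqrt d * connLength (fun i => (Δ i : B1Eq324BenfattoLemma.Site d)) + d))) ≤ Mt :=
    fun c => weightedMass_classes_le (s := s) (D := D) (κ := κ) (J := J) (L := L) (w := w) (v := v) (m := m) hA0 hres hA hv c
  calc _ ≤ ∏ _j : Fin (k + 1), Mt := Finset.prod_le_prod (fun j _ => hmass0 (f j)) fun j _ => hMt' (f j)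
    _ = Mt ^ (k + 1) := by rw [Finset.prod_const, Finset.card_univ, Fintype.card_fin]

/-- **THE WITHIN-BOX COLOURINGS OF ONE STEP, SUMMED**: `|Σ_{m∈B}Σ_{f uses Ψ″₁ and Ψ₂}𝓔^T_{P̂₀}(f)| ≤ |B|·3^{k+1}·2^{(k+1)D}2^{2^{(k+1)D}}K₀^{(k+1)D}·
e^{−(δ/2)(v+1)}·M̃^{k+1}` (at most `3^{k+1}` colourings per box; `abs_W29_le` each) — the `|Σ_□W₂₉,k(□)|` of `…Sect5Identification`'s `idErr`.
[cite: BenfattoEtAl1978, (5.29) p.157, Appendix D p.166] -/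
theorem abs_sum_W29_le (hα : 0 < α) (hβ : 0 < β) (hd : 0 < d) (hJ : CoefSupportedIn a J) {A : ℝ} (hA0 : 0 ≤ A)
    (hA : ∀ (p : ℕ) (Δ : Fin p → B1Eq324BenfattoLemma.Site d) (n : Fin p → ℕ), |a p Δ n| ≤ A) (hv : v ≤ w)
    {δ : ℝ} (hδ0 : 0 ≤ δ) (hδle : δ ≤ Real.log ((2 * d + α ^ 2) / (2 * d))) (hres : 0 < κ / 2 - δ / 2 * ((D : ℝ) ^ 2 * Real.sqrt d))
    (k : ℕ) :
    |∑ m ∈ B, ∑ f ∈ univ.filter (fun f : Fin (k + 1) → Fin 3 => (∃ j, f j = 1) ∧ ∃ j, f j = 2),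
        ursellOf (fun P : Finset (Fin (k + 1)) => ∫ z, ∏ j ∈ P,
          (![fun z => psi1p s D κ a L w v m z, fun z => psi1pp s D κ a L w v m z, fun z => psi2 s D κ a L w m z] (f j)) z
            ∂P0 d α β) univ| ≤
      B.card * ((3 : ℝ) ^ (k + 1) *
        (2 ^ ((k + 1) * D) * 2 ^ 2 ^ ((k + 1) * D) * (max 1 (freeCov d α β 0 0)) ^ ((k + 1) * D) *
            Real.exp (-(δ / 2 * ((v : ℝ) + 1))) *
          (A * Real.exp (δ / 2 * ((D : ℝ) ^ 2 * d)) * (L : ℝ) ^ d * ∑ p ∈ Finset.Icc 1 s, ((admissible p D).card : ℝ) *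
            ((2 / (1 - Real.exp (-((κ / 2 - δ / 2 * ((D : ℝ) ^ 2 * Real.sqrt d)) / (p : ℕ) / Real.sqrt d))) *
              Real.exp ((κ / 2 - δ / 2 * ((D : ℝ) ^ 2 * Real.sqrt d)) / (p : ℕ) / Real.sqrt d)) ^ d) ^ (p - 1)) ^ (k + 1))) := by
  set bnd : ℝ := 2 ^ ((k + 1) * D) * 2 ^ 2 ^ ((k + 1) * D) * (max 1 (freeCov d α β 0 0)) ^ ((k + 1) * D) *
        Real.exp (-(δ / 2 * ((v : ℝ) + 1))) *
      (A * Real.exp (δ / 2 * ((D : ℝ) ^ 2 * d)) * (L : ℝ) ^ d * ∑ p ∈ Finset.Icc 1 s, ((admissible p D).card : ℝ) *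
        ((2 / (1 - Real.exp (-((κ / 2 - δ / 2 * ((D : ℝ) ^ 2 * Real.sqrt d)) / (p : ℕ) / Real.sqrt d))) *
          Real.exp ((κ / 2 - δ / 2 * ((D : ℝ) ^ 2 * Real.sqrt d)) / (p : ℕ) / Real.sqrt d)) ^ d) ^ (p - 1)) ^ (k + 1) with hbnd
  have hbox : ∀ m ∈ B, |∑ f ∈ univ.filter (fun f : Fin (k + 1) → Fin 3 => (∃ j, f j = 1) ∧ ∃ j, f j = 2),
      ursellOf (fun P : Finset (Fin (k + 1)) => ∫ z, ∏ j ∈ P,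
        (![fun z => psi1p s D κ a L w v m z, fun z => psi1pp s D κ a L w v m z, fun z => psi2 s D κ a L w m z] (f j)) z
          ∂P0 d α β) univ| ≤ (3 : ℝ) ^ (k + 1) * bnd := by
    intro m _
    refine (Finset.abs_sum_le_sum_abs _ _).trans ?_
    have hterm : ∀ f ∈ univ.filter (fun f : Fin (k + 1) → Fin 3 => (∃ j, f j = 1) ∧ ∃ j, f j = 2),
        |ursellOf (fun P : Finset (Fin (k + 1)) => ∫ z, ∏ j ∈ P,
          (![fun z => psi1p s D κ a L w v m z, fun z => psi1pp s D κ a L w v m z, fun z => psi2 s D κ a L w m z] (f j)) z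
            ∂P0 d α β) univ| ≤ bnd := fun f hf => by
      obtain ⟨h1, h2⟩ := (Finset.mem_filter.1 hf).2
      exact abs_W29_le hα hβ hd hJ hA0 hA hv hδ0 hδle hres m k f h1 h2
    refine (Finset.sum_le_sum hterm).trans ?_
    rw [Finset.sum_const, nsmul_eq_mul]
    have hbnd0 : 0 ≤ bnd := by
      rw [hbnd]
      refine mul_nonneg (mul_nonneg (mul_nonneg (mul_nonneg (pow_nonneg (by norm_num) _) (pow_nonneg (by norm_num) _))
        (pow_nonneg (zero_le_one.trans (le_max_left _ _)) _)) (Real.exp_pos _).le) (pow_nonneg ?_ _)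
      refine mul_nonneg (mul_nonneg (mul_nonneg hA0 (Real.exp_pos _).le) (pow_nonneg (Nat.cast_nonneg _) _))
        (latticeSumConst_nonneg hres.le)
    have hcard : (((univ.filter (fun f : Fin (k + 1) → Fin 3 => (∃ j, f j = 1) ∧ ∃ j, f j = 2)).card : ℕ) : ℝ) ≤ (3 : ℝ) ^ (k + 1) := by
      have h := Finset.card_filter_le (univ : Finset (Fin (k + 1) → Fin 3)) (fun f => (∃ j, f j = 1) ∧ ∃ j, f j = 2)
      rw [Finset.card_univ, Fintype.card_fun, Fintype.card_fin, Fintype.card_fin] at h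
      exact_mod_cast h
    exact mul_le_mul_of_nonneg_right hcard hbnd0
  refine (Finset.abs_sum_le_sum_abs _ _).trans ((Finset.sum_le_sum hbox).trans ?_)
  rw [Finset.sum_const, nsmul_eq_mul]

end W29

end Literature.MathematicalPhysics.QuantumFieldTheory.Balaban1983to89.B1Eq324BenfattoSect5IdErrBounds

end
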